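import Mathlib
import HarnessLib
import HarnessLib.Audit
import Summits.HodgeConjecture.Statement
import Literature.AlgebraicGeometry.HodgeTheory.HodgeConjecture
import Literature.AlgebraicGeometry.HodgeTheory.AlgebraicClasses

/-!
Route: HeightMassDefect

Route HeightMassDefect realises idea card height-mass-defect-normal-functions (which absorbed
biextension-height-monge-ampere-atoms). X (it suffices to show) = MASS DEFECT: for every smooth
projective X^{2m} ⊂ P^n over ℂ (m ≥ 1), H = O_X(1), and every non-zero rational primitive
(m,m)-class ζ there are k ≥ 1 and 2 ≤ j ≤ N_k := dim |kH| with M_j(k) < δ_k^j. Notation: U_k = |kH|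
∖ X̂_k (complement of the dual variety), ν_{ζ,k} the admissible normal function of ζ on U_k
(KerrPearlstein2011 §3.2–3.3, (3-5)), h_k Hain's height function of the biextension variation of
(ν_{ζ,k}, ν_{ζ,k}^∨), i.e. the metric |V| = e^{−h_k} on the Hain–Reed biextension line bundle, h_k
plurisubharmonic (BrosnanPearlstein2019 Thm 16 = PearlsteinPeters2019), β_k := dd^c h_k ≥ 0 the
height form on U_k, δ_k := ∫_{U_k} β_k ∧ ω_FS^{N_k−1} = ∫_ℓ β_k (a.e. line ℓ) the degree of the
height current (finite: h_k has logarithmic growth along X̂_k, BrosnanPearlstein2019 Thms 13–14, so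
β_k extends by zero to a closed positive (1,1)-current on |kH| ≅ P^{N_k}), and 0 ≤ M_j(k) := ∫_{U_k}
β_k^j ∧ ω_FS^{N_k−j} ≤ δ_k^j its non-pluripolar Monge–Ampère masses (BoucksomEtAl2010). In words:
the height current of the Griffiths–Green normal function, a closed positive (1,1)-current on the
complete linear system, does NOT have full Monge–Ampère mass — mass is lost into the dual variety;
by b-divisor Chern–Weil (BoteroBurgosHolmesDeJong2022) and the asymptotic height pairing
(BrosnanPearlstein2019 Cor 7, Thm 13) the lost mass sits exactly at the points of X̂_k where ν_{ζ,k}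
is singular, so MassDefect is Green–Griffiths' Conjecture 41 turned into ONE strict inequality
between two numbers. Chain: MassDefect ⟹ [crux MassDefectDetectsSingularity] sing_p(ν_{ζ,k}) ≠ 0 for
some p ∈ X̂_k ⟹ [support SingularityForcesSectionRestriction: KerrPearlstein2011 (3-7),
BrosnanFangNiePearlstein2009, DecataldoMigliorini2009] ζ|_{X_p} ≠ 0 ⟹ typed landing pad
`SectionRestriction` (Conj. 41 in algebraic clothing: every non-zero middle rational Hodge class on
an even-dimensional X restricts non-trivially to some hypersurface section of some |kH|) ⟹
[Assembly: KerrPearlstein2011 Thm 42 'if' direction + Thomas2005Nodes Prop 2] HodgeConjecture. Typed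
one-liner of the landing pad (Sketch.lean rc 0): SectionRestriction := ∀ m X, IsSmoothProjective
(2(m+1)) X → ∀ (e : ProjectiveEmbedding X) (c : complexBetti X (2(m+1))), IsRationalClass c →
IsOfHodgeType (2(m+1)) X (2(m+1)) (m+1) (m+1) c → c ≠ 0 → ∃ k F Z, 0 < k ∧ F.IsHomogeneous k ∧ Z =
e.ι⁻¹ V₊(F) ∧ Z ≠ univ ∧ (restriction of c to {P ∈ X(ℂ) | P.pt ∈ Z}) ≠ 0; Assembly :=
SectionRestriction → HodgeConjecture. The analytic objects (ν, sing_p, h_k, non-pluripolar masses)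
do not exist in Lean/Mathlib: the three mechanism cruxes (InteriorMassAsymptotics r2,
HeightDegreeFormula r3, MassDefectDetectsSingularity r4) and the target MassDefect are filed
informal with definition requests, and are to become the glued split of `SectionRestriction`
(children MassDefect, MassDefectDetectsSingularity, SingularityForcesSectionRestriction; glue C₁ →
C₂ → C₃ → SectionRestriction) once the definitions land; the typed cruxes at open are the two
landing pads SectionRestrictionFourfold (r5, = HC for fourfolds, first theatre of the engine) and
SectionRestriction (r6).

Rationale: WHY THIS LINE (imports pluripotential theory / Arakelov-type heights into the Green–Griffiths
programme). GG/BFNP/dCM proved HC ⟺ "ν_ζ is singular somewhere on |kH|, k ≫ 0" (KerrPearlstein2011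
Conj 41/Thm 42; BrosnanPearlstein2019 Conj 8/Thm 9) and stalled on PRODUCING a singularity:
singularities live on strata of codimension ≥ 2 of the dual variety, invisible to pencils (barrier
NormalFunctions). Hain–Reed/Pearlstein–Peters/Brosnan–Pearlstein give ν_ζ a canonical psh HEIGHT h_k
whose log-poles along test curves occur exactly at singular points (BP Cor 7, (a)/(b) p.6), and
Botero–Burgos–Holmes–de Jong / Burgos–Kramer–Kühn show that for such metrics Chern–Weil holds for a
b-DIVISOR whose volume drops below the naive degree exactly when the local height functions are
non-linear. Joining the two: HC(X,ζ) ⟺ the height current on P^{N_k} loses non-pluripolar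
Monge–Ampère mass (thesis). Gain: "∃ point of a countable union of strata where a transcendental
section misbehaves" becomes ONE strict inequality M_j(k) < δ_k^j between two numbers attached to one
explicit positive current on projective space, with positivity on our side twice (β_k ≥ 0; defect ≥
0) and a free semiclassical parameter k; the natural habitat of BEGZ/Demailly/Bergman-kernel
technology, none of which has been pointed at normal functions.
RANKED CRUXES. r2 InteriorMassAsymptotics (informal; engine E1): k → ∞ expansions of M_j(k) and δ_k
by Bergman/Toeplitz localisation of the fibre integrals of ‖δν_ζ‖² over P(H⁰(kH)), with a
coefficient discrepancy for every ζ ≠ 0 — hardest, decides whether the engine exists. r3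
HeightDegreeFormula (informal; E2, the KappaFormula carried over from the absorbed card): closed
forms for δ_k, the codim-1 Lear coefficient μ_k and the canonical-extension class d_k (GRR/Deligne
pairing à la HainReed2004; one-node nilpotent orbit). r4 MassDefectDetectsSingularity (informal;
dictionary): M_N(k) < δ_k^N ⟺ sing ≠ 0 somewhere, via BP Thm 13/Cor 7 + b-divisor Chern–Weil
(BoteroBurgosHolmesDeJong2022, GilKramerKuhn2016) + BEGZ; phrased with b-divisors/non-pluripolar
mass, not pointwise Lelong numbers (audit refuter-5-0). r5 SectionRestrictionFourfold (typed): the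
landing statement for fourfolds = HC for fourfolds (BFNP §6, n = 2), first theatre after the surface
calibration. r6 SectionRestriction (typed): the landing statement in all even dimensions = Conj 41 ⟺
HC. Supports: FourfoldCriterion (typed glue r5 → HC(4)), SectionRestrictionSurface (typed
calibration, KP Ex 43), HeightPackage (informal: CONSTRUCTION statement of the posited interface (ν,
B_k, h_k, β_k, δ_k, M_j) from Hain/PP/BP/El Mir–Skoda/BEGZ), SingularityForcesSectionRestriction
(informal: KP (3-7)), SurfaceCalibration (informal experiment gating r2), target MassDefect
(informal). Assembly := SectionRestriction → HodgeConjecture (KP Thm 42 'if': weights +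
Hodge–Riemann + induction on even dimension; Thomas2005Nodes Prop 2 + Remark 1).
KILL CRITERIA. (i) Surface calibration: for a K3/abelian/cubic surface and a primitive divisor class
the computed k-expansions of M_2(k) and δ_k² agree to all visible orders although reducible members
(jumps) exist ⟹ r2 dead; route survives only if r3 + r4 yield a non-asymptotic inequality, else
close exhausted. (ii) Any admissible self-dual biextension variation of geometric origin (BP's
examples, Ceresa over M̄_g: HainReed2004, BrosnanPearlstein2019 §1.1) singular at a point but with
height current of FULL non-pluripolar mass near it ⟹ r4 refuted ⟹ close (the reformulation dies;
Conj 41 lives on in sibling routes). (iii) r5/r6 refuted = counterexample to HC (route and summit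
negative).
DELIBERATELY NOT DECOMPOSED. E3 (Demailly–Siu: located generic Lelong numbers along deep multi-nodal
strata ≈ Thomas' nodal classes) stays a fallback inside r4's text; the Toeplitz model of δν; j = 2
versus j = N_k; effective k₀ (KP Rem 44); the odd-degree/imprimitive bookkeeping and Thomas'
Hilbert-scheme spreading (inside Assembly); merging with sibling card
height-jump-curve-test-fourfolds (targeted certified jumps on ρ_prim = 1 fourfolds) — its protocol
would discharge r5 instances and can share FourfoldCriterion by signature.
PRIOR-PROGRAMME NOTES: docs/m5/inspiration not read (plancard mode; card-driven).
NOVELTY / BARRIERS: see the dedicated sections (searched 2026-08-15: zbMATH 5 queries, lit vsearch,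
galaxy (0 hits), frontier/bridges; OpenAlex/S2 rate-limited, searchd rc 75).

Novelty: Nearest prior art: (1) FRAME in print and already pointed at HC — BrosnanPearlstein2019 READ pp.3–6:
Conj 8/Thm 9 (HC ⟺ singular ν_ζ), Cor 7 (h(t) ≥ 0, ≡ 0 iff sing = 0), Thm 13 + (a)/(b): h̄ → −∞
along test curves exactly at singular points, 'HC would imply the biextension metric does not
extend'; KerrPearlstein2011 pp.321–324 READ (Conj 41, Thm 42 and its proof); Thomas2005Nodes pp.3–5
READ. (2) MASS technology exists, never applied to normal functions: BoteroBurgosHolmesDeJong2022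
and GilKramerKuhn2016 (b-divisor Chern–Weil/Hilbert–Samuel for psh metrics with toroidal
singularities; height jumping = non-functoriality of Mumford–Lear extensions),
BurgosgilHolmesJong2018, BoucksomEtAl2010 (non-pluripolar products, full mass), Zelditch1998
(Bergman asymptotics). (3) 'Compute the biextension class two ways + positivity' as an INEQUALITY
engine: HainReed2004, Hain2013NormalFunctions (Ceresa over M̄_g, Moriwaki-type slope inequalities).
DELTA: run (3) as an EXISTENCE engine for singularities of ν_ζ on |kH| for arbitrary (X,ζ): HC ⟺
'the height current on P^{N_k} is not of full non-pluripolar mass', attacked by k → ∞ semiclassical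
expansion of interior masses (E1) against a GRR/Deligne-pairing degree formula (E2), with the
b-divisor dictionary (r4) as the proved-looking hinge; plus the first typed Lean rendering of Conj
41 (SectionRestriction) and its bridge to the summit. Grade claimed: new-combination (card audit
refuter-5-0: frame known, engine not found in print). SEARCH LOG  [refs: 10.1093/imrn/rnx169, doi:10.1093/imrn/rnx169, BrosnanPearlstein2019, KerrPearlstein2011, BoteroBurgosHolmesDeJong2022, GilKramerKuhn2016, BurgosgilHolmesJong2018, BoucksomEtAl2010, Zelditch1998, HainReed2004]

Barriers (technique_class: normal-functions, pluripotential-theory, complex-analytic): technique_class: normal-functions, pluripotential-theory, complex-analytic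
- Literature.Barriers.HodgeConjecture.Voisin2003_generalHypersurface_noIntegralClassInF (Lefschetz
pencil + Jacobi inversion dead for m > 1; Green–Voisin torsion of normal functions over étale
covers): evaded by design — no Jacobi inversion, no surjectivity of Abel–Jacobi, no pencil: the
normal function of the FIXED class ζ lives over the complete linear system |kH| and is only asked
where it is SINGULAR (the barrier file's own recorded evasion, KP §3.1–3.3); 1-nodal points (all a
pencil sees) carry neither singularities nor Lelong mass (h̄ continuous there, BrosnanPearlstein2019
Thm 14), and the defect is sought in Monge–Ampère degree j ≥ 2, i.e. on strata of codimension ≥ 2.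
- Literature.Barriers.HodgeConjecture.Clemens1983_griffithsGroup_infiniteRank (no
finite-rank/representability; 'induction via pencils' blocked): the only induction is KP Thm 42's
(weights + Hodge–Riemann + HC one even dimension down + Thomas' Hilbert-scheme spreading), which
never parametrises cycle groups; infinitely generated Griffiths groups are irrelevant to the sign of
one mass defect.
- Literature.Barriers.HodgeConjecture.Zucker1977_kaehlerTorus_noAnalyticCycles and
Literature.Barriers.HodgeConjecture.Voisin2002_weilTorus_hodgeClassWithoutSubvarieties
(Kähler-only/complex-analytic methods cannot prove HC): projectivity is used essentially and visibly
— very ample H, |kH| ≅ P^N, the dual variety, admissibility of ν_ζ (algeb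

sub-problem: HodgeConjecture · status: done · opened planner-plancard-HodgeConjecture-HodgeConject-cbef88e7-0 2026-08-15T11:04:52Z · rev 1 · ledger route-HodgeConjecture-HeightMassDefect
GENERATED by the gate from the ledger (D-0016/17). Provers cite these decls: `theorem foo : Summit.HodgeConjecture.HodgeConjecture.Theses.HeightMassDefect.<Decl> := …` in Summits/HodgeConjecture/HodgeConjecture/Theorems/<Name>.lean.
-/

namespace Summit.HodgeConjecture.HodgeConjecture.Theses.HeightMassDefect

open scoped BigOperators Topology Manifold Classical MeasureTheory ProbabilityTheory Matrix InnerProductSpace ComplexConjugate ContinuousMap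
open Filter Set Function TopologicalSpace MeasureTheory

attribute [summit_statement] _root_.HodgeConjecture

-- item stmt-HodgeConjecture-2819 · target · rank 0 · open · by planner — informal only, no Lean statement yet:
--   [target] THESIS X (informal until definitions BiextensionHeightPackage /
--   NonPluripolarMongeAmpereMass land). For X^{2m} ⊂ P^n smooth projective over ℂ (m ≥ 1), H = O_X(1), ζ
--   ∈ H^{2m}(X,ℚ) ∩ H^{m,m} primitive (ζ ∪ c₁(H) = 0), ζ ≠ 0: ∃ k ≥ 1 ∃ j ∈ [2, N_k] with M_j(k) <
--   δ_k^j, where (notation of the thesis / HeightPackage) U_k = |kH| ∖ X̂_k, h_k = Hain height of the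
--   biextension variation of (ν_{ζ,k}, ν_{ζ,k}^∨) (BrosnanPearlstein2019 §1, Thm 16), β_k = dd^c h_k ≥ 0
--   on U_k, δ_k = ∫_{U_k} β_k ∧ ω_FS^{N_k−1} (degree of the El Mir–Skoda extension Ť_k of β_k to
--   P^{N_k}), M_j(k) = ∫_{U_k} β_k^j ∧ ω_FS

-- item stmt-HodgeConjecture-2820 · crux · rank 2 · open · by planner — informal only, no Lean statement yet:
--   [crux r2 — ENGINE E1, hardest and most informative] For (X^{2m}, H, ζ) as in MassDefect and fixed j
--   (first j = 2; also j = N_k, the total mass): as k → ∞ the interior masses M_j(k) = ∫_{U_k} β_k^j ∧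
--   ω_FS^{N_k−j} and the degree δ_k admit asymptotic expansions in k (powers of k, possibly log k
--   factors) whose leading and first subleading coefficients are explicit integrals over X (and over X ×
--   X for the bilocal part of M_j, j ≥ 2) of |ζ_harm|²_ω, the curvature of ω = c₁(H) and universal
--   constants in (m, j) — obtained by Bergman-kernel / Toeplitz-operator localisation
--   (Tian–Zelditch–Catlin, Zeldit

-- item stmt-HodgeConjecture-2821 · crux · rank 3 · open · by planner — informal only, no Lean statement yet:
--   [crux r3 — ENGINE E2, the KappaFormula carried over from the absorbed card
--   biextension-height-monge-ampere-atoms] For (X^{2m}, H, ζ, k): closed formulas, as functions of k, m,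
--   the Chern/degree data of (X,H) and Q(ζ,ζ), for (a) δ_k = ∫_ℓ β_k (general line ℓ ⊂ |kH|); (b) the
--   codimension-one Lear coefficient μ_k of h_k along the 1-nodal locus X̂_k^{sm} (BrosnanPearlstein2019
--   Thm 13/14, Remark 12: h_k ∼ −μ_k log|s| transversally, h̄_k = h_k + μ_k log|s| continuous; μ_k from
--   the ONE-NODE nilpotent orbit: N of rank one, N² = 0, N v₀ = μ v₋₂); (c) the class d_k ∈ ℚ of BP's
--   canonical extension L̄_can

-- item stmt-HodgeConjecture-2822 · crux · rank 4 · open · by planner — informal only, no Lean statement yet: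
--   [crux r4 — DICTIONARY, both directions] For (X,H,ζ,k) as in MassDefect: M_{N_k}(k) < δ_k^{N_k} ⟺ ∃ p
--   ∈ X̂_k with sing_p(ν_{ζ,k}) ≠ 0 (non-torsion singularity, KerrPearlstein2011 Def 38; torsion ones
--   excluded, KP Thm 37); and for 2 ≤ j < N_k, M_j(k) < δ_k^j ⟹ the same. Proof route: pass to a log
--   resolution S̄ → |kH| of X̂_k with unipotent local monodromies (finite base changes); there h̄_k has
--   singularities governed by the asymptotic height pairing h(t)(ν,ν^∨) on the monodromy cones
--   (BrosnanPearlstein2019 Thm 13: h(m) = Σ m_jμ_j − μ(V)(m); Cor 7: h(t) ≥ 0, ≡ 0 iff sing = 0; cases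
--   (a)/(b) p.6: h

/-- item stmt-HodgeConjecture-2514 · crux · rank 5 · open · by planner
why it might fail: = HC for fourfolds (BFNP 2009 sec.6, n=2: a section carrying c yields an algebraic 2-cycle via Lefschetz (1,1) on a resolution; HC => it by HR + Bertini-type containment). Open already for sextics in P^5. Closes only via the analytic chain r2-r4; false iff some fourfold violates HC.
sources: BrosnanFangNiePearlstein2009, KerrPearlstein2011, Thomas2005Nodes, DecataldoMigliorini2009, arXiv:0711.0964
[crux] LANDING STATEMENT, DIMENSION 4 (first theatre of the engine after the surface calibration):
for every smooth projective fourfold X ⊂ P^n (embedding e, H = O(1)) and every non-zero rational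
(2,2)-class c there is a hypersurface section Z = X ∩ V₊(F), F homogeneous of degree k ≥ 1 not
vanishing on X, with c|_{Z(ℂ)} ≠ 0 in H⁴(Z(ℂ); ℂ). For c with c ∪ h ≠ 0 a smooth hyperplane section
works (Gysin isomorphism); for primitive c this is Green–Griffiths Conj. 41 for X read through
KerrPearlstein2011 (3-7) (sing_p ν_{c,k} ≠ 0 ⟹ c|_{X_p} ≠ 0; ⟺ for k ≫ 0, DecataldoMigliorini2009,
BrosnanFangNiePearlstein2009). By BFNP §6 (Lemma 48, Thm 51, n = 2) it is EQUIVALENT to HC for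
fourfolds (glue: support FourfoldCriterion). In this route it is to be discharged by MassDefect →
MassDefectDetectsSingularity (r4) → SingularityForcesSectionRestriction; the sibling card
height-jump-curve-test-fourfolds would discharge instances (ρ_prim = 1) by certified height jumps.
NOT for direct attack (that is HC(4)). Refuters: test the RENDERING (zero-locus preimage, Z ≠ univ,
restriction via the subtype of complex points over Z) where HC(4) is known (products of surfaces,
cubic fourfolds). -/
@[route_item "route-HodgeConjecture-HeightMassDefect"]
def SectionRestrictionFourfold : Prop :=
  ∀ ⦃X : Literature.AlgebraicGeometry.Motives.SchemeOver ℂ⦄, Literature.AlgebraicGeometry.Motives.IsSmoothProjective 4 X → ∀ (e : Literature.AlgebraicGeometry.Motives.ProjectiveEmbedding X) (c : Literature.AlgebraicGeometry.HodgeTheory.complexBetti X 4), Literature.AlgebraicGeometry.HodgeTheory.IsRationalClass c → Literature.AlgebraicGeometry.HodgeTheory.IsOfHodgeType 4 X 4 2 2 c → c ≠ 0 → ∃ (k : ℕ) (F : MvPolynomial (Fin (e.n + 1)) ℂ) (Z : Set X.left), 0 < k ∧ F.IsHomogeneous k ∧ Z = e.ι.left.base ⁻¹' (letI := MvPolynomial.gradedAlgebra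 (σ := Fin (e.n + 1)) (R := ℂ); ProjectiveSpectrum.zeroLocus (MvPolynomial.homogeneousSubmodule (Fin (e.n + 1)) ℂ) {F}) ∧ Z ≠ Set.univ ∧ Literature.AlgebraicTopology.SingularHomology.singularCohomology.map ℂ ℂ (⟨Subtype.val, continuous_subtype_val⟩ : C({P : Literature.AlgebraicGeometry.Motives.ComplexPoints X // P.pt ∈ Z}, Literature.AlgebraicGeometry.Motives.ComplexPoints X)) 4 c ≠ 0

/-- item stmt-HodgeConjecture-2515 · crux · rank 6 · open · by planner
why it might fail: Equivalent to HC (KP2011 Thm 42 'if' + Thomas Prop 2; HC => it by Hodge-Riemann + Bertini-type containment): unprovable directly, it is the LANDING PAD of the chain MassDefect -> sing_p != 0 -> restriction != 0 (informal r2-r4). False iff HC fails; e ranges over all embeddings (harmless, k free).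
sources: KerrPearlstein2011, Thomas2005Nodes, BrosnanFangNiePearlstein2009, DecataldoMigliorini2009, GreenGriffiths2007Singularities, BrosnanPearlstein2019
[crux] LANDING STATEMENT, ALL EVEN DIMENSIONS 2(m+1) = Green–Griffiths / KerrPearlstein2011 Conj. 41
= BrosnanPearlstein2019 Conj. 8 in algebraic clothing: every non-zero rational middle Hodge class c
on a smooth projective X^{2(m+1)} ⊂ P^n restricts non-trivially to some hypersurface section Z = X ∩
V₊(F) ∈ |kH| (singular when c is primitive: primitive = killed by smooth sections).
KerrPearlstein2011 pp.323–324 (READ): sing_p(ν_ζ) ≠ 0 ⟹ ζ|_{X_p} ≠ 0 ⟹ (weights; Hodge–Riemann on a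
resolution; HC one even dimension down + pencil/Hilbert-scheme spreading, Thomas2005Nodes Prop 2) ζ
pairs with an algebraic cycle — this is Assembly. Conversely HC ⟹ SectionRestriction elementarily
(Q(ζ,ζ) ≠ 0 for primitive ζ ≠ 0, so a component W of an algebraic representative has ∫_W ζ ≠ 0, and
W lies on a hypersurface section of large degree). Hence EQUIVALENT to HC. Role: the node that the
analytic chain MassDefect → MassDefectDetectsSingularity (r4) → SingularityForcesSectionRestriction
closes; to be SPLIT into exactly those children (glue C₁ → C₂ → C₃ → SectionRestriction) once the
definition requests land. NOT for direct attack; refuters: test the Lean RENDERING where HC is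
known. -/
@[route_item "route-HodgeConjecture-HeightMassDefect"]
def SectionRestriction : Prop :=
  ∀ ⦃m : ℕ⦄ ⦃X : Literature.AlgebraicGeometry.Motives.SchemeOver ℂ⦄, Literature.AlgebraicGeometry.Motives.IsSmoothProjective (2 * (m + 1)) X → ∀ (e : Literature.AlgebraicGeometry.Motives.ProjectiveEmbedding X) (c : Literature.AlgebraicGeometry.HodgeTheory.complexBetti X (2 * (m + 1))), Literature.AlgebraicGeometry.HodgeTheory.IsRationalClass c → Literature.AlgebraicGeometry.HodgeTheory.IsOfHodgeType (2 * (m + 1)) X (2 * (m + 1)) (m + 1) (m + 1) c → c ≠ 0 → ∃ (k : ℕ) (F : MvPolynomial (Fin (e.n + 1)) ℂ) (Z : Set X.left), 0 < k ∧ F.IsHomogeneous k ∧ Z = e.ι.left.base ⁻¹' (letI := MvPolynomial.gradedAlgebra (σ := Fin (e.n + 1)) (R := ℂ); ProjectiveSpectrum.zeroLocus (MvPolynomial.homogeneousSubmodule (Fin (e.n + 1)) ℂ) {F}) ∧ Z ≠ Set.univ ∧ Literature.AlgebraicTopology.SingularHomology.singularCohomology.map ℂ ℂ (⟨Subtype.val,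 continuous_subtype_val⟩ : C({P : Literature.AlgebraicGeometry.Motives.ComplexPoints X // P.pt ∈ Z}, Literature.AlgebraicGeometry.Motives.ComplexPoints X)) (2 * (m + 1)) c ≠ 0

/-- item stmt-HodgeConjecture-2516 · support · rank 9 · closed · proved by Summit.HodgeConjecture.HodgeConjecture.Theorems.heightMassDefect_fourfoldCriterion_proof @ 8c4f411acce2 (prover) · by planner
sources: BrosnanFangNiePearlstein2009, Thomas2005Nodes, KerrPearlstein2011
[support] GLUE FOR DIMENSION 4 (BrosnanFangNiePearlstein2009 §6, n = 2; Thomas2005Nodes §3 Rem. 1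
(Totaro, weights); no induction needed): SectionRestrictionFourfold ⟹ HodgeConjectureFor 4 X for all
smooth projective fourfolds. p = 0: hodgeConjectureFor_codim_zero; p = 1: Lefschetz (1,1) (tree
LefschetzOneOne*); p = 2: if Alg² ⊊ Hdg⁴(X) pick c ≠ 0 Hodge, Q-orthogonal to Alg² (Q non-degenerate
on Hdg⁴ by Hodge–Riemann); get Z with c|_Z ≠ 0; W₃H⁴(Z) = ker(H⁴(Z) → H⁴(Z̃)) for a resolution Z̃
(Resolution.Hironaka1964_projective) and im H⁴(X) is pure of weight 4, so c|_Y ≠ 0 on a component Y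
of Z̃ (dim 2 or 3); non-degeneracy on Hdg(Y) gives ξ ∈ Hdg^{2dim Y−4}(Y) = divisor classes (dim 3,
Lefschetz (1,1)) or H⁰ (dim 2) with ∫ c|_Y ∪ ξ ≠ 0, i.e. an algebraic 2-cycle g_*W with c·[g_*W] ≠ 0
— contradiction; p = 3: hard Lefschetz L²: H² ≅ H⁶ over ℚ carries divisor classes onto curve classes
H·H·D; p = 4: TopDegreeClasses.mem_algebraicClasses_of_degree_top; p > 4: subsingleton_complexBetti;
Nonempty (HodgeModel 4 X): HodgeModelExistence. Classical but heavy; shareable by signature with a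
route of the sibling card height-jump-curve-test-fourfolds. -/
@[route_item "route-HodgeConjecture-HeightMassDefect"]
def FourfoldCriterion : Prop :=
  SectionRestrictionFourfold → ∀ ⦃X : Literature.AlgebraicGeometry.Motives.SchemeOver ℂ⦄, Literature.AlgebraicGeometry.Motives.IsSmoothProjective 4 X → Literature.AlgebraicGeometry.HodgeTheory.HodgeConjectureFor 4 X

/-- item stmt-HodgeConjecture-2517 · support · rank 9 · closed · proved by Summit.HodgeConjecture.HodgeConjecture.Theorems.heightMassDefect_sectionRestrictionSurface_proof @ 6d22d6b0912e (prover) · by planner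
sources: KerrPearlstein2011, VoisinHodgeI2002
[support] CALIBRATION m = 0 (surfaces; KerrPearlstein2011 Example 43): every non-zero rational
(1,1)-class c on a smooth projective surface X ⊂ P^n restricts non-trivially to some (reducible)
curve section Z = X ∩ V₊(F). Proof: Lefschetz (1,1) (tree LefschetzOneOne*) gives Hdg²(X) = span of
curve classes; the intersection form on Hdg²(X) is non-degenerate (Hodge index / Hodge–Riemann, cf.
Sweep1.HodgeIndexSurfaceStatement), so some irreducible curve C has c · C = ∫_C c ≠ 0, hence c|_C ≠
0; C lies on a hypersurface section Z of large degree not containing X (F ∈ I(C)_k ∖ I(X)_k), and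
c|_Z restricts further to c|_C ≠ 0. Validates the typed rendering (zero-locus preimage under e.ι,
complex points over Z, restriction map) where everything is known; the case the analytic
SurfaceCalibration experiment must reproduce. -/
@[route_item "route-HodgeConjecture-HeightMassDefect"]
def SectionRestrictionSurface : Prop :=
  ∀ ⦃X : Literature.AlgebraicGeometry.Motives.SchemeOver ℂ⦄, Literature.AlgebraicGeometry.Motives.IsSmoothProjective 2 X → ∀ (e : Literature.AlgebraicGeometry.Motives.ProjectiveEmbedding X) (c : Literature.AlgebraicGeometry.HodgeTheory.complexBetti X 2), Literature.AlgebraicGeometry.HodgeTheory.IsRationalClass c → Literature.AlgebraicGeometry.HodgeTheory.IsOfHodgeType 2 X 2 1 1 c → c ≠ 0 → ∃ (k : ℕ) (F : MvPolynomial (Fin (e.n + 1)) ℂ) (Z : Set X.left), 0 < k ∧ F.IsHomogeneous k ∧ Z = e.ι.left.base ⁻¹' (letI := MvPolynomial.gradedAlgebra (σ := Fin (e.n + 1)) (R := ℂ); ProjectiveSpectrum.zeroLocus (MvPolynomial.homogeneousSubmodule (Fin (e.n + 1)) ℂ) {F}) ∧ Z ≠ Set.univ ∧ Literature.AlgebraicTopology.SingularHomology.singularCohomology.map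 ℂ ℂ (⟨Subtype.val, continuous_subtype_val⟩ : C({P : Literature.AlgebraicGeometry.Motives.ComplexPoints X // P.pt ∈ Z}, Literature.AlgebraicGeometry.Motives.ComplexPoints X)) 2 c ≠ 0

-- item stmt-HodgeConjecture-2823 · support · rank 9 · open · by planner — informal only, no Lean statement yet:
--   [support — CONSTRUCTION statement of the posited interface; definition requests
--   AdmissibleNormalFunctionSingularity, BiextensionHeightPackage, NonPluripolarMongeAmpereMass] For
--   X^{2m} ⊂ P^n smooth projective, ζ primitive rational (m,m), k ≥ 1, with P_k = |kH| ≅ P^{N_k}, X̂_k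
--   the dual variety, U_k = P_k ∖ X̂_k: (i) the admissible normal function ν_{ζ,k} ∈ ANF(U_k,
--   ℋ_k)/J^m(X) of ζ exists (Deligne-cohomology lift; Saito admissibility; KerrPearlstein2011
--   (3-4),(3-5), Lemma 40; ℋ_k = variable cohomology, BrosnanPearlstein2019 §1.1); (ii) the Hain–Reed
--   biextension line bundle B_k = L(ν,ν^∨) on U_k

-- item stmt-HodgeConjecture-2824 · support · rank 9 · open · by planner — informal only, no Lean statement yet:
--   [support — known theorem, to be typed once AdmissibleNormalFunctionSingularity lands] For X^{2m} ⊂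
--   P^n (embedding e, H = O(1)), ζ primitive rational (m,m), k ≥ 1 and p ∈ X̂_k: sing_p(ν_{ζ,k}) ≠ 0 ⟹
--   ζ|_{X_p} ≠ 0 in H^{2m}(X_p(ℂ); ℚ), X_p = X ∩ V₊(F_p) the (singular) member of |kH| at p — the
--   commutative square KerrPearlstein2011 (3-7): sing_p ∘ AJ = β_p ∘ α_p with α_p the restriction map
--   (BrosnanFangNiePearlstein2009; DecataldoMigliorini2009: moreover β_p is injective on im α_p for k ≫
--   0, so ⟺ there). Since for k ≫ 0 every member of |kH| is cut out by a form F of degree k on P^{e.n}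
--   (Serre vani

-- item stmt-HodgeConjecture-2825 · support · rank 9 · open · by planner — informal only, no Lean statement yet:
--   [support — EXPERIMENT gating r2 (both card audits: cheap and decisive, do it first)] m = 1: X ⊂ P³ a
--   smooth quartic K3 containing a line L (alternatives: a cubic surface; an abelian surface), ζ a
--   primitive rational divisor class (e.g. [L] − (L·H/H²)[H]), k = 1, 2, 3 (N_k = 3, 9, 19 for the
--   quartic): here ℋ_k = H¹ of the curves X_s, ν_{ζ,k}(s) = ζ|_{X_s} ∈ Pic⁰(X_s) ⊗ ℚ, h_k = the
--   archimedean (Néron–Tate-type) height ⟨ν,ν⟩ of this family of degree-0 divisor classes (Hain 1990 /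
--   HainReed2004: for curves the biextension height is the archimedean height pairing), β_k = dd^c h_k.
--   Singular points of

/-- item stmt-HodgeConjecture-2518 · assembly · rank 1 · closed · proved by Summit.HodgeConjecture.HodgeConjecture.Theorems.heightMassDefect_assembly_proof @ 35cfea34ad94 (prover) · by planner
sources: KerrPearlstein2011, Thomas2005Nodes, BrosnanFangNiePearlstein2009
[assembly] SectionRestriction → HodgeConjecture = KerrPearlstein2011 Thm 42 ('if') without normal
functions + Thomas2005Nodes Prop 2. Plan: (1) MHC(2j) := 'middle-degree rational Hodge classes on
smooth projective 2j-folds are algebraic', by induction on j: MHC(2) = Lefschetz (1,1); for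
MHC(2(m+1)) take c ≠ 0 Hodge, Q-orthogonal to Alg (HR non-degeneracy on Hodge classes), Z from
SectionRestriction, a resolution Z̃ → Z (Hironaka fact); weights (ker(H^k(Z) → H^k(Z̃)) = W_{k−1},
image of H^{2(m+1)}(X) pure) ⟹ c|_Y ≠ 0 on a component Y^d, m+1 ≤ d ≤ 2m+1; HR on Y gives ξ ∈
Hdg^{2(d−m−1)}(Y) with ∫ c|_Y ∪ ξ ≠ 0; ξ is algebraic by Thomas' DOWNWARD induction 'HC(k,d) ⟸
HC(k,d−1) for k < d/2' (pencil + relative Hilbert scheme, Thomas2005Nodes p.4) bottoming out at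
MHC(2(d−m−1)), d−m−1 ≤ m; so c·g_*[W] ≠ 0 for an algebraic cycle — contradiction. (2) all (X,p) from
MHC: Thomas Prop 2 (2p < n downward induction; 2p > n hard Lefschetz + Gysin surjective on Hodge
classes) ; HodgeModel conjunct: HodgeModelExistence. INTENDED CHAIN (glued split of
SectionRestriction later): MassDefect → MassDefectDetectsSingularity (r4) →
SingularityForcesSectionRestriction → SectionRestriction → Assembly → Hodge -/
@[route_item "route-HodgeConjecture-HeightMassDefect"]
def Assembly : Prop :=
  SectionRestriction → HodgeConjecture

end Summit.HodgeConjecture.HodgeConjecture.Theses.HeightMassDefect
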